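import Summits.NavierStokesRegularity.NavierStokesRegularity.Theorems.TerminalTraceTypeITraceScarL3LogMeanApexUnit
import Summits.NavierStokesRegularity.NavierStokesRegularity.Theorems.TerminalTraceTypeITraceScarL3ExtinctApexDOfL3TraceConst
import HarnessLib

/-!
# T28-C «CEILING AND MEAN» (ROUND-28 §3), general viscosity: a Type-I blow-up whose local rate at a singular
# point has log-window means below `ν` leaves no `L³` scar there
# (item `TerminalTrace.TypeITraceScarL3`, stmt-NavierStokesRegularity-18385, Stub LOUD line; helper)

Seat nsreg-C26-p1 g2 (cell ns-regularity-ideate), `--supports stmt-NavierStokesRegularity-18385` (helper);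
planner-of-record nsreg-p2 g29 (ROUND-28 §3 T28-C: the window «log-window mean of (T−t)‖u‖²_{L^∞(B_ρ(x₀))}
< 2ν»), DIRECTOR-NS #130 (2).

* **`typeITraceScarL3_of_logMean_lt`** — the log-mean successor of T27-C
  (`typeITraceScarL3_of_eventualRate_sq_lt_two_nu`): a classical Leray–Hopf flow on `[0,T)` with viscosity
  `ν`, blowing up at `T` with an eventual Type-I rate of ANY constant `C`, a singular point `x₀`
  (`‖u‖_{L^∞(Q_r(T,x₀))} = ∞` for all `r`), and a measurable local rate `b` at `x₀` (`‖u(t, x)‖ ≤ b(t)` for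
  `T − δ_b < t < T`, `|x − x₀| < ρ_b`) whose log-window `lintegral`s obey
  `∫⁻_{]t',t[} b² ≤ ofReal(2qν·log((T−t')/(T−t)) + K₀)` with `q < 1`, `K₀ ≥ 0`, has `u(T) ∉ L³(B(x₀, ρ))` for
  every `ρ > 0`.  Proof: viscosity normalisation `v(s, x) = ν⁻¹u(s/ν, x)` (rate `b_v(s) = ν⁻¹ b(s/ν)`, whose
  windows carry `q` and slack `K₀/ν` by the change of variables `setLIntegral_Ioo_comp_mul_left`), then
  `not_memLp_three_of_logMean_lt_one_unit`.  T27-C is the case `b = C/√(T−t)`, `q = C²/(2ν)`, `K₀ = 0`.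

WHAT THIS IS NOT: not Stub LOUD, not item 18385 for every Type-I blow-up, NOT a proof of Navier–Stokes
regularity — a statement about hypothetical blow-ups in the log-mean window.
[folklore; Ghidaglia 1986; Agmon–Nirenberg 1967; CaffarelliKohnNirenberg1982 Thm B; Leray1934; Seregin2014 §6.6]
-/

noncomputable section

set_option linter.dupNamespace false

namespace Summit.NavierStokesRegularity.NavierStokesRegularity.Theorems.TypeITraceScarL3

open MeasureTheory Set Function Filter Topology TopologicalSpace Metric
open Literature.Analysis.FluidPDE
open scoped NNReal ENNReal InnerProductSpace RealInnerProductSpace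

/-- **T28-C, general viscosity** (module docstring). [folklore; Ghidaglia 1986; Agmon–Nirenberg 1967;
CaffarelliKohnNirenberg1982 Thm B; Seregin2014 §6.6 Prop. 6.20] -/
theorem typeITraceScarL3_of_logMean_lt :
    ∀ (ν T : ℝ), 0 < ν → 0 < T →
      ∀ (u : ℝ → EuclideanSpace ℝ (Fin 3) → EuclideanSpace ℝ (Fin 3))
        (p : ℝ → EuclideanSpace ℝ (Fin 3) → ℝ),
      IsClassicalNSSolutionOn (Ico 0 T) ν 0 u p → IsLerayHopfOn T ν 0 (u 0) u →
      ∀ C : ℝ, 0 ≤ C → (∀ᶠ t in 𝓝[<] T, ∀ x, ‖u t x‖ ≤ C / Real.sqrt (T - t)) →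
      ∀ x₀ : EuclideanSpace ℝ (Fin 3),
      (∀ r : ℝ, 0 < r →
        eLpNorm (uncurry u) ⊤ (volume.restrict (parabolicCylinder r (T, x₀))) = ⊤) →
      ∀ (b : ℝ → ℝ) (δb ρb q K₀ : ℝ), Measurable b → 0 < δb → 0 < ρb → 0 ≤ K₀ → q < 1 →
      (∀ t ∈ Ioo (T - δb) T, ∀ x ∈ ball x₀ ρb, ‖u t x‖ ≤ b t) →
      (∀ t' t : ℝ, T - δb < t' → t' ≤ t → t < T →
        ∫⁻ τ in Ioo t' t, ENNReal.ofReal (b τ ^ 2) ≤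
          ENNReal.ofReal (2 * q * ν * Real.log ((T - t') / (T - t)) + K₀)) →
      ∀ ρ : ℝ, 0 < ρ → ¬ MemLp (u T) 3 (volume.restrict (ball x₀ ρ)) := by
  intro ν T hν hT u p hcl hLH C hC0 hC x₀ hsing b δb ρb q K₀ hbm hδb hρb hK₀ hq hb hLM ρ hρ hmem
  have hν0 : ν ≠ 0 := hν.ne'
  have hνi : 0 < ν⁻¹ := inv_pos.2 hν
  have hνT : 0 < ν * T := mul_pos hν hT
  have hnotbd : ¬ IsBackwardBoundedAt u T x₀ := not_isBackwardBoundedAt_of_forall_eLpNorm_top hsing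
  -- ## viscosity normalisation `v(s, x) = ν⁻¹ u(s/ν, x)`, blow-up time `νT` (as in `extinctApexD_of_L3trace_const`)
  set v : ℝ → EuclideanSpace ℝ (Fin 3) → EuclideanSpace ℝ (Fin 3) := timeRescale ν⁻¹ ν⁻¹ u with hv
  set pv : ℝ → EuclideanSpace ℝ (Fin 3) → ℝ := timeRescale ν⁻¹ (ν⁻¹ ^ 2) p with hpv
  have hmaps : MapsTo (fun s => ν⁻¹ * s) (Ico 0 (ν * T)) (Ico 0 T) := by
    intro s hs
    refine ⟨mul_nonneg hνi.le hs.1, ?_⟩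
    calc ν⁻¹ * s < ν⁻¹ * (ν * T) := mul_lt_mul_of_pos_left hs.2 hνi
      _ = T := by rw [← mul_assoc, inv_mul_cancel₀ hν0, one_mul]
  have hclv : IsClassicalNSSolutionOn (Ico 0 (ν * T)) 1 0 v pv := by
    have h := hcl.viscosityRescale_set hν0 hmaps (uniqueDiffOn_Ico 0 (ν * T))
    rwa [timeRescale_zero_force] at h
  have hv0 : ν⁻¹ • u 0 = v 0 := by
    funext x
    simp [hv]
  have hLHv : IsLerayHopfOn (ν * T) 1 0 (v 0) v := by
    have h := hLH.viscosityRescale hνi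
    have e1 : T / ν⁻¹ = ν * T := by rw [div_inv_eq_mul, mul_comm]
    rwa [e1, inv_mul_cancel₀ hν0, timeRescale_zero_force, hv0] at h
  have e0 : ν⁻¹ * (ν * T) = T := by rw [← mul_assoc, inv_mul_cancel₀ hν0, one_mul]
  have eδ : ν⁻¹ * (ν * T - ν * δb) = T - δb := by
    rw [mul_sub, ← mul_assoc, inv_mul_cancel₀ hν0, one_mul, ← mul_assoc, inv_mul_cancel₀ hν0, one_mul]
  have htend : Tendsto (fun s : ℝ => ν⁻¹ * s) (𝓝[<] (ν * T)) (𝓝[<] T) := by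
    refine tendsto_nhdsWithin_of_tendsto_nhds_of_eventually_within _ ?_ ?_
    · have h := ((continuous_const_mul ν⁻¹).tendsto (ν * T)).mono_left
        (nhdsWithin_le_nhds (s := Iio (ν * T)))
      rwa [e0] at h
    · refine eventually_nhdsWithin_of_forall fun s hs => ?_
      have h := mul_lt_mul_of_pos_left (mem_Iio.1 hs) hνi
      rwa [e0] at h
  have hnorm : ∀ s x, ‖v s x‖ = ν⁻¹ * ‖u (ν⁻¹ * s) x‖ := fun s x => by
    rw [hv, timeRescale_apply, norm_smul, Real.norm_eq_abs, abs_of_pos hνi]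
  have hIv : ∀ᶠ s in 𝓝[<] (ν * T), ∀ x, ‖v s x‖ ≤ (C / Real.sqrt ν) / Real.sqrt (ν * T - s) := by
    filter_upwards [htend.eventually hC, self_mem_nhdsWithin] with s hs hsT x
    have hsT' : s < ν * T := hsT
    have hpos : 0 < ν * T - s := sub_pos.2 hsT'
    have e : T - ν⁻¹ * s = ν⁻¹ * (ν * T - s) := by field_simp
    have hsq : Real.sqrt (T - ν⁻¹ * s) = (Real.sqrt ν)⁻¹ * Real.sqrt (ν * T - s) := by
      rw [e, Real.sqrt_mul hνi.le, Real.sqrt_inv]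
    have hb' := hs x
    rw [hsq] at hb'
    have hsν : 0 < Real.sqrt ν := Real.sqrt_pos.2 hν
    have hsνsq : Real.sqrt ν * Real.sqrt ν = ν := Real.mul_self_sqrt hν.le
    have hsqpos : 0 < Real.sqrt (ν * T - s) := Real.sqrt_pos.2 hpos
    rw [le_div_iff₀ (by positivity)] at hb'
    have hνinv : ν⁻¹ = (Real.sqrt ν)⁻¹ * (Real.sqrt ν)⁻¹ := by rw [← mul_inv, hsνsq]
    have key : ν⁻¹ * ‖u (ν⁻¹ * s) x‖ ≤ C / Real.sqrt ν / Real.sqrt (ν * T - s) := by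
      rw [le_div_iff₀ hsqpos]
      calc ν⁻¹ * ‖u (ν⁻¹ * s) x‖ * Real.sqrt (ν * T - s)
          = (Real.sqrt ν)⁻¹ * (‖u (ν⁻¹ * s) x‖ * ((Real.sqrt ν)⁻¹ * Real.sqrt (ν * T - s))) := by
              rw [hνinv]; ring
        _ ≤ (Real.sqrt ν)⁻¹ * C := mul_le_mul_of_nonneg_left hb' (inv_nonneg.2 hsν.le)
        _ = C / Real.sqrt ν := by rw [div_eq_inv_mul]
    exact (hnorm s x) ▸ key
  have hC1 : 0 ≤ C / Real.sqrt ν := div_nonneg hC0 (Real.sqrt_nonneg _)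
  have hnotbdv : ¬ IsBackwardBoundedAt v (ν * T) x₀ := not_isBackwardBoundedAt_viscosityRescale hν hnotbd
  have hmemv : MemLp (v (ν * T)) 3 (volume.restrict (ball x₀ ρ)) := by
    have e : v (ν * T) = fun x => ν⁻¹ • u T x := by
      funext x
      rw [hv, timeRescale_apply, ← mul_assoc, inv_mul_cancel₀ hν0, one_mul]
    rw [e]
    exact hmem.const_smul ν⁻¹
  -- ## the rescaled local rate `b_v(s) = ν⁻¹ b(s/ν)` on `]νT − νδ_b, νT[ × B(x₀, ρ_b)`
  have hbvm : Measurable fun s => ν⁻¹ * b (ν⁻¹ * s) :=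
    measurable_const.mul (hbm.comp (measurable_const.mul measurable_id))
  have hδbv : 0 < ν * δb := mul_pos hν hδb
  have hbv : ∀ s ∈ Ioo (ν * T - ν * δb) (ν * T), ∀ x ∈ ball x₀ ρb, ‖v s x‖ ≤ ν⁻¹ * b (ν⁻¹ * s) := by
    intro s hs x hx
    rw [hnorm]
    refine mul_le_mul_of_nonneg_left (hb (ν⁻¹ * s) ⟨?_, ?_⟩ x hx) hνi.le
    · have h := mul_lt_mul_of_pos_left hs.1 hνi
      rwa [eδ] at h
    · have h := mul_lt_mul_of_pos_left hs.2 hνi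
      rwa [e0] at h
  have hLMv : ∀ t' t : ℝ, ν * T - ν * δb < t' → t' ≤ t → t < ν * T →
      ∫⁻ τ in Ioo t' t, ENNReal.ofReal ((ν⁻¹ * b (ν⁻¹ * τ)) ^ 2) ≤
        ENNReal.ofReal (2 * q * Real.log ((ν * T - t') / (ν * T - t)) + ν⁻¹ * K₀) := by
    intro t' t h1 h2 h3
    have hpt : ∀ τ : ℝ, ENNReal.ofReal ((ν⁻¹ * b (ν⁻¹ * τ)) ^ 2) =
        ENNReal.ofReal (ν⁻¹ ^ 2) * ENNReal.ofReal (b (ν⁻¹ * τ) ^ 2) := by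
      intro τ
      rw [← ENNReal.ofReal_mul (by positivity), mul_pow]
    simp_rw [hpt]
    rw [lintegral_const_mul' _ _ ENNReal.ofReal_ne_top,
      setLIntegral_Ioo_comp_mul_left (fun τ => ENNReal.ofReal (b τ ^ 2)) hνi, ← mul_assoc,
      ← ENNReal.ofReal_mul (by positivity), inv_inv]
    have e3 : ν⁻¹ ^ 2 * ν = ν⁻¹ := by field_simp
    rw [e3]
    have h1' : T - δb < ν⁻¹ * t' := by
      have h := mul_lt_mul_of_pos_left h1 hνi
      rwa [eδ] at h
    have h2' : ν⁻¹ * t' ≤ ν⁻¹ * t := mul_le_mul_of_nonneg_left h2 hνi.le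
    have h3' : ν⁻¹ * t < T := by
      have h := mul_lt_mul_of_pos_left h3 hνi
      rwa [e0] at h
    refine (mul_le_mul' le_rfl (hLM _ _ h1' h2' h3')).trans ?_
    rw [← ENNReal.ofReal_mul hνi.le]
    refine ENNReal.ofReal_le_ofReal (le_of_eq ?_)
    have e4 : (T - ν⁻¹ * t') / (T - ν⁻¹ * t) = (ν * T - t') / (ν * T - t) := by
      have e5 : T - ν⁻¹ * t' = ν⁻¹ * (ν * T - t') := by field_simp
      have e6 : T - ν⁻¹ * t = ν⁻¹ * (ν * T - t) := by field_simp
      rw [e5, e6, mul_div_mul_left _ _ hνi.ne']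
    rw [e4]
    have hinv : ν⁻¹ * ν = 1 := inv_mul_cancel₀ hν0
    linear_combination (2 * q * Real.log ((ν * T - t') / (ν * T - t))) * hinv
  -- ## the unit-viscosity theorem
  exact not_memLp_three_of_logMean_lt_one_unit hνT hclv hLHv hC1 hIv x₀ hnotbdv hbvm hδbv hρb
    (mul_nonneg hνi.le hK₀) hbv hLMv hq hρ hmemv

end Summit.NavierStokesRegularity.NavierStokesRegularity.Theorems.TypeITraceScarL3

end
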